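import Literature.IUT.HodgeTheaters.DiscreteProfiniteConjugatesSurfaceFacts
import Literature.IUT.HodgeTheaters.DiscreteProfiniteConjugatesRankTwo
import Mathlib.GroupTheory.Subgroup.Centralizer
import HarnessLib

/-!
# [IUTchI] Thm 2.6 / Cor 2.8 / Lem 2.7 (vi)(vii) AS TYPED from Lemma 2.7 (i), (iii), (iv) AS TYPED
# and the classical facts [Stb2] + Riemann–Hurwitz

Mochizuki, *Inter-universal Teichmüller theory I*, kurims manuscript (May 2020), §2, Theorem 2.6 p. 56
(proof pp. 56–57: "it follows from Lemma 2.7, (iv) … by applying Lemma 2.7, (ii) … by Lemma 2.7, (v)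
… `G` is conjugacy separable … [Stb1], Theorem 1, when `G` is free; [Stb2], Theorem 3.3, when `G` is an
orientable surface group … by applying Lemma 2.7, (iii)"), Lemma 2.7 p. 57, Corollary 2.8 p. 59
[cite: Mochizuki2012, Thm 2.6 pp.56-59] (D-0012 claim key; series status DISPUTED — classical group
theory here; Remark 2.8.1: the surface case is off the IUT route).

The printed proof of Theorem 2.6 is an INFERENCE from the named statements of Lemma 2.7 plus
conjugacy separability.  This file kernel-checks that inference for the statements AS TYPED in
`DiscreteProfiniteConjugates.lean`: the named Props `ProfiniteConjugatesOfDiscreteSubgroups` (Thm 2.6),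
`SubgroupsOfComplexHyperbolicPi1` (Cor 2.8), `FreeOrSurface.centralizerCommutatorKernelTrivial`
(Lem 2.7 (vi)) and `FreeOrSurface.autFixingCommutatorKernelTrivial` (Lem 2.7 (vii)) follow from the named
Props `FreeOrSurface.twoGeneratedSubgroupFree` (Lem 2.7 (i)), `FreeOrSurface.rankTwoInAbelianization`
(Lem 2.7 (iii)), `FreeOrSurface.abelianSubgroupCyclic` (Lem 2.7 (iv)) together with the two classical
NAMED FACTS `SurfaceGroupConjugacySeparable` ([Stb2] = Stebe 1972 Thm 3.3) and
`SurfaceGroupFiniteIndexSubgroup` (Riemann–Hurwitz, ZVC 1980 4.14.22/23) of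
`Literature/GroupTheory/CombinatorialGroupTheory/SurfaceGroupConjugacySeparable.lean`.  (The free
halves are unconditional theorems of the tree, abc-iut-L5-t9; the route replaces the printed uses of
Lemma 2.7 (ii)/(v) by the centralizer condition in `F̂` derived from hereditary conjugacy separability,
`ProfiniteCompletionCentralizersCS.lean`; Lemma 2.7 (v) is NOT used.)

New group theory proved here: `isCyclic_centralizer_of_lemma27` — in a group in which every
two-generated subgroup is free (Lem 2.7 (i)) and every abelian subgroup is cyclic (Lem 2.7 (iv)), the
centralizer of every non-trivial element is cyclic (two elements commuting with `u ≠ 1` are powers of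
roots `r, s` of `u`, and `r^l = s^n` in the free group `⟨r, s⟩` forces `r s = s r`).

With abc-iut-L5-d1's `FreeOrSurface.twoGeneratedSubgroupFree_holds` / `rankTwoInAbelianization_holds` /
`abelianSubgroupCyclic_holds` the three Lemma-2.7 hypotheses are discharged by name, leaving the four
statements conditional on exactly the two classical named facts.  Proof-only file; typed ≠ discharged;
nothing restated.
-/

namespace Literature.IUT.HodgeTheaters

open Literature.GroupTheory.CombinatorialGroupTheory (SurfaceGroupConjugacySeparable
  SurfaceGroupFiniteIndexSubgroup)

universe u

namespace FreeOrSurface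

/-! ### Cyclic centralizers from Lemma 2.7 (i) and (iv) -/

/-- An element commuting with `u` is, together with `u`, a power of a common root, provided every
abelian subgroup is cyclic (apply (iv) to the abelian subgroup `⟨x, u⟩`). [cite: Mochizuki2012, Lem 2.7(iv) p.57] -/
theorem exists_common_root_of_commute {G : Type u} [Group G]
    (hIV : ∀ J : Subgroup G, (∀ a ∈ J, ∀ b ∈ J, a * b = b * a) → IsCyclic J)
    {x u : G} (hxu : x * u = u * x) : ∃ (r : G) (k l : ℤ), r ^ k = x ∧ r ^ l = u := by
  set J : Subgroup G := Subgroup.closure ({x, u} : Set G) with hJ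
  have hcomm : ∀ a ∈ ({x, u} : Set G), ∀ b ∈ ({x, u} : Set G), a * b = b * a := by
    intro a ha b hb
    simp only [Set.mem_insert_iff, Set.mem_singleton_iff] at ha hb
    rcases ha with rfl | rfl <;> rcases hb with rfl | rfl
    · rfl
    · exact hxu
    · exact hxu.symm
    · rfl
  haveI : IsMulCommutative J := Subgroup.isMulCommutative_closure hcomm
  have hJab : ∀ a ∈ J, ∀ b ∈ J, a * b = b * a := fun a ha b hb => setLike_mul_comm ha hb
  obtain ⟨r, hr⟩ := (Subgroup.isCyclic_iff_exists_zpowers_eq_top J).mp (hIV J hJab)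
  have hx : x ∈ Subgroup.zpowers r := by rw [hr]; exact Subgroup.subset_closure (by simp)
  have hu : u ∈ Subgroup.zpowers r := by rw [hr]; exact Subgroup.subset_closure (by simp)
  obtain ⟨k, hk⟩ := Subgroup.mem_zpowers_iff.mp hx
  obtain ⟨l, hl⟩ := Subgroup.mem_zpowers_iff.mp hu
  exact ⟨r, k, l, hk, hl⟩

/-- In a group in which every two-generated subgroup is free, a non-trivial relation `r^l = s^n`
(`l, n ≠ 0`) forces `r` and `s` to commute (the free group `⟨r, s⟩` has rank `≤ 1`).
[cite: Mochizuki2012, Lem 2.7(i) p.57] -/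
theorem commute_of_zpow_eq_zpow_of_twoGenFree {G : Type u} [Group G]
    (hI : ∀ x y : G, IsFreeGroup (Subgroup.closure ({x, y} : Set G)))
    {r s : G} {l n : ℤ} (hl : l ≠ 0) (h : r ^ l = s ^ n) : r * s = s * r := by
  haveI := hI r s
  set H : Subgroup G := Subgroup.closure ({r, s} : Set G) with hH
  have hrH : r ∈ H := Subgroup.subset_closure (by simp)
  have hsH : s ∈ H := Subgroup.subset_closure (by simp)
  have hpow : (⟨r, hrH⟩ : H) ^ l = (⟨s, hsH⟩ : H) ^ n := by
    apply Subtype.ext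
    simp only [SubgroupClass.coe_zpow, h]
  have hrel : (⟨r, hrH⟩ : H) ^ l * (⟨s, hsH⟩ : H) ^ (-n) = 1 := by
    rw [zpow_neg, hpow, mul_inv_cancel]
  have hln : ((l, -n) : ℤ × ℤ) ≠ (0, 0) := fun h0 => hl (Prod.mk.inj h0).1
  have hc := commute_of_zpow_mul_zpow_eq_one hln hrel
  exact congrArg Subtype.val hc

/-- **Cyclic centralizers from Lemma 2.7 (i) and (iv).**  If every two-generated subgroup of `G` is
free and every abelian subgroup of `G` is cyclic, then the centralizer of every `u ≠ 1` is cyclic.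
[cite: Mochizuki2012, Lem 2.7(iv) p.57] -/
theorem isCyclic_centralizer_of_lemma27 (G : Type u) [Group G]
    (hI : ∀ x y : G, IsFreeGroup (Subgroup.closure ({x, y} : Set G)))
    (hIV : ∀ J : Subgroup G, (∀ a ∈ J, ∀ b ∈ J, a * b = b * a) → IsCyclic J)
    (u : G) (hu : u ≠ 1) : IsCyclic (Subgroup.centralizer ({u} : Set G)) := by
  refine hIV _ fun c hc d hd => ?_
  rw [Subgroup.mem_centralizer_singleton_iff] at hc hd
  -- `c = r^k`, `u = r^l`; `d = s^m`, `u = s^n`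
  obtain ⟨r, k, l, hrk, hrl⟩ := exists_common_root_of_commute hIV hc
  obtain ⟨s, m, n, hsm, hsn⟩ := exists_common_root_of_commute hIV hd
  have hl : l ≠ 0 := by rintro rfl; exact hu (by rw [← hrl, zpow_zero])
  -- `r^l = s^n = u` in the free group `⟨r, s⟩` forces `r s = s r`
  have hrs : r * s = s * r := commute_of_zpow_eq_zpow_of_twoGenFree hI hl (hrl.trans hsn.symm)
  rw [← hrk, ← hsm]
  exact (Commute.zpow_zpow hrs k m).eq

/-- **(Z) for orientable surface groups from the named statements Lemma 2.7 (i) and (iv).**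
[cite: Mochizuki2012, Lem 2.7(iv) p.57] -/
theorem isCyclic_centralizer_surfaceCase_of_lemma27 (hI : twoGeneratedSubgroupFree.{u})
    (hIV : abelianSubgroupCyclic.{u}) :
    ∀ (S : Type u) [Group S], IsOrientableSurfaceGroup S → ∀ u : S, u ≠ 1 →
      IsCyclic (Subgroup.centralizer ({u} : Set S)) :=
  fun S _ hS u hu => isCyclic_centralizer_of_lemma27 S (hI S (Or.inr hS)) (hIV S (Or.inr hS)) u hu

/-! ### The four named statements from Lemma 2.7 (i)(iii)(iv) and the two classical facts -/

/-- **[IUTchI] Theorem 2.6 AS TYPED from Lemma 2.7 (i), (iii), (iv) AS TYPED, [Stb2] and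
Riemann–Hurwitz** — the printed inference of pp. 56–57, kernel-checked (free half: the tree's
unconditional theorem). [cite: Mochizuki2012, Thm 2.6 pp.56-57] -/
theorem profiniteConjugatesOfDiscreteSubgroups_of_lemma27 (hCS : SurfaceGroupConjugacySeparable)
    (hFI : SurfaceGroupFiniteIndexSubgroup) (hI : twoGeneratedSubgroupFree.{u})
    (hIII : rankTwoInAbelianization.{u}) (hIV : abelianSubgroupCyclic.{u}) :
    ProfiniteConjugatesOfDiscreteSubgroups.{u} :=
  profiniteConjugatesOfDiscreteSubgroups_of_surfaceFacts hCS hFI (fun S _ hS => hIII S (Or.inr hS))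
    (isCyclic_centralizer_surfaceCase_of_lemma27 hI hIV) (fun S _ hS => hIV S (Or.inr hS))

/-- **[IUTchI] Corollary 2.8 AS TYPED from the same inputs** (Remark 2.8.1).
[cite: Mochizuki2012, Cor 2.8 p.59] -/
theorem subgroupsOfComplexHyperbolicPi1_of_lemma27 (hCS : SurfaceGroupConjugacySeparable)
    (hFI : SurfaceGroupFiniteIndexSubgroup) (hI : twoGeneratedSubgroupFree.{u})
    (hIII : rankTwoInAbelianization.{u}) (hIV : abelianSubgroupCyclic.{u}) :
    SubgroupsOfComplexHyperbolicPi1.{u} :=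
  subgroupsOfComplexHyperbolicPi1_of_thm26 (profiniteConjugatesOfDiscreteSubgroups_of_lemma27 hCS hFI hI hIII hIV)

/-- **[IUTchI] Lemma 2.7 (vi) AS TYPED from Lemma 2.7 (i), (iii), (iv) AS TYPED, [Stb2] and
Riemann–Hurwitz.** [cite: Mochizuki2012, Lem 2.7(vi) pp.58-59] -/
theorem centralizerCommutatorKernelTrivial_of_lemma27 (hCS : SurfaceGroupConjugacySeparable)
    (hFI : SurfaceGroupFiniteIndexSubgroup) (hI : twoGeneratedSubgroupFree.{u})
    (hIII : rankTwoInAbelianization.{u}) (hIV : abelianSubgroupCyclic.{u}) :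
    centralizerCommutatorKernelTrivial.{u} :=
  centralizerCommutatorKernelTrivial_of_surfaceFacts hCS hFI (fun S _ hS => hIII S (Or.inr hS))
    (isCyclic_centralizer_surfaceCase_of_lemma27 hI hIV)

/-- **[IUTchI] Lemma 2.7 (vii) AS TYPED from the same inputs** ((vi) ⇒ (vii), p. 59).
[cite: Mochizuki2012, Lem 2.7(vii) p.59] -/
theorem autFixingCommutatorKernelTrivial_of_lemma27 (hCS : SurfaceGroupConjugacySeparable)
    (hFI : SurfaceGroupFiniteIndexSubgroup) (hI : twoGeneratedSubgroupFree.{u})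
    (hIII : rankTwoInAbelianization.{u}) (hIV : abelianSubgroupCyclic.{u}) :
    autFixingCommutatorKernelTrivial.{u} :=
  autFixingCommutatorKernelTrivial_of_centralizer
    (centralizerCommutatorKernelTrivial_of_lemma27 hCS hFI hI hIII hIV)

end FreeOrSurface

end Literature.IUT.HodgeTheaters
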